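import Literature.NumberTheory.Sieve.QuadraticRootsPrimeModuliTothLinear
import Literature.NumberTheory.Sieve.QuadraticRootsPrimeModuliTothBilinear
import HarnessLib

/-!
# Tóth 2000 (positive discriminant), IV: the theorem from the two analytic inputs in parametric shape (PROVED)

Topic `Literature/NumberTheory/Sieve`, fourth companion of the named fact
`Literature.NumberTheory.Sieve.toth2000_quadraticRoots_primeModuli` (`PolynomialCongruencesPrimeModuli.lean`;
Á. Tóth, *Roots of quadratic congruences*, IMRN 2000:14, 719–739: for every irreducible quadratic
`f ∈ ℤ[X]` of positive discriminant and every `h ≠ 0`, `∑_{p ≤ x} ρ_h(p) = o(π(x))`).  It joins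
`QuadraticRootsPrimeModuliTothLinear.lean` ((34) from a linear-form bound `K d^θ M^{1−θ+η}`,
`η < 2εθ`) and `QuadraticRootsPrimeModuliTothBilinear.lean` ((35) from a bilinear-form bound
`‖αρ‖ ‖β‖ (M^{1/2} + N^a M^b)`, `κ = 1/2 − b − (1/3 − ε)(a − b) > 0`) with DFI's Theorem 5 (PROVED,
`dukeFriedlanderIwaniec1995_theorem5_holds`) and the §7 assembly
(`toth2000_quadraticRoots_primeModuli_of_theorem5`):

* `toth2000_quadraticRoots_primeModuli_of_linearFormBound_of_bilinearFormBound`;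
* `toth2000_quadraticRoots_primeModuli_of_tothLinearFormBound_of_bilinearFormBound` (the linear input
  in the `L`-family form printed for Tóth's estimate, [cite: Ngo2024, (1.3)]).

With this, everything in the proof of [cite: Toth2000, main theorem] along the lines of
[cite: DukeFriedlanderIwaniec1995, §§6–7] is proved except the two analytic inputs themselves —
Tóth's linear-form estimate (shape [cite: Ngo2024, (1.3)]: `θ = 1/(4L)`, `η = 1/L²`, `L > 2/ε`) and
his bilinear-form estimate (the analogue of [cite: DukeFriedlanderIwaniec1995, Proposition 2],
from the smoothed linear forms by Cauchy's inequality) — both resting on the spectral theory of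
Poincaré series on `Γ₀(q)` attached to indefinite binary quadratic forms, absent from Mathlib.  No
named fact is introduced.

## References

* Á. Tóth, *Roots of quadratic congruences*, Internat. Math. Res. Notices 2000, no. 14, 719–739.
  [cite: Toth2000, main theorem]
* W. Duke, J. B. Friedlander, H. Iwaniec, Ann. of Math. (2) 141 (1995), 423–441: Propositions 1–2,
  Theorem 5 (p. 437), §7 (p. 438). [cite: DukeFriedlanderIwaniec1995, §7]
* H. T. Ngo, Bull. Lond. Math. Soc. 56 (2024) 2886–2910, §1 (1.3). [cite: Ngo2024, §1 (1.3)]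
-/

namespace Literature.NumberTheory.Sieve

open scoped BigOperators Polynomial
open Filter Asymptotics Finset Polynomial

/-! ### Tóth's theorem from the two analytic inputs in parametric shape -/

/-- **Tóth's theorem from a power-saving linear-form bound and a bilinear-form bound of shape
`M^{1/2} + N^a M^b` (PROVED reduction).**  Suppose that for every irreducible quadratic `f ∈ ℤ[X]`
of positive discriminant, every `h ≥ 1` and every `0 < ε ≤ 1/12`:
(i) for some `0 < θ ≤ 1`, `0 ≤ η < 2εθ` and `K`, `|L_d(M)| ≤ K d^θ M^{1−θ+η}` for `1 ≤ d ≤ M`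
(Tóth: `θ = 1/(4L)`, `η = 1/L²`, `L > 2/ε` [cite: Ngo2024, (1.3)]); and
(ii) for some `0 ≤ b ≤ a` with `1/2 − b − (1/3 − ε)(a − b) > 0` and `K₂`,
`|B(M, N')(α|_{(M,2M]}, β|_S)| ≤ K₂ ‖αρ‖ ‖β‖ (M^{1/2} + N'^a M^b)` for `M, N' ≥ 1`, `S ⊆ (N', 2N']`,
`β` on primes (the shape of Tóth's analogue of [cite: DukeFriedlanderIwaniec1995, Proposition 2]).
Then `toth2000_quadraticRoots_primeModuli` holds: (34) by `DFI1995.hyp34_of_linearFormBound`, (35) by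
`DFI1995.hyp35_of_bilinearFormBound` (both with `|ρ_{h'}(n)| ≤ C_f τ(n)`,
`exists_norm_polyRootWeylSum_le_of_irreducible`), then Theorem 5 (PROVED,
`dukeFriedlanderIwaniec1995_theorem5_holds`) via `toth2000_quadraticRoots_primeModuli_of_theorem5`.  Everything except the two analytic inputs
(i), (ii) — the spectral theory of [cite: Toth2000, main theorem] — is thereby proved.
[cite: Toth2000, main theorem]; [cite: DukeFriedlanderIwaniec1995, §7 p. 438] -/
theorem toth2000_quadraticRoots_primeModuli_of_linearFormBound_of_bilinearFormBound
    (HL : ∀ f : ℤ[X], f.natDegree = 2 → Irreducible f →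
      0 < discrim (f.coeff 2) (f.coeff 1) (f.coeff 0) → ∀ h : ℕ, 1 ≤ h →
      ∀ ε : ℝ, 0 < ε → ε ≤ 1 / 12 →
      ∃ θ η K : ℝ, 0 < θ ∧ θ ≤ 1 ∧ 0 ≤ η ∧ η < 2 * ε * θ ∧
        ∀ d : ℕ, 1 ≤ d → ∀ M : ℝ, (d : ℝ) ≤ M →
          ‖DFI1995.linearForm f h d M‖ ≤ K * (d : ℝ) ^ θ * M ^ (1 - θ + η))
    (HB : ∀ f : ℤ[X], f.natDegree = 2 → Irreducible f →
      0 < discrim (f.coeff 2) (f.coeff 1) (f.coeff 0) → ∀ h : ℕ, 1 ≤ h →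
      ∀ ε : ℝ, 0 < ε → ε ≤ 1 / 12 →
      ∃ a b K₂ : ℝ, 0 ≤ b ∧ b ≤ a ∧ 0 < 1 / 2 - b - (1 / 3 - ε) * (a - b) ∧
        ∀ M N' : ℝ, 1 ≤ M → 1 ≤ N' → ∀ (α β : ℕ → ℂ) (S : Finset ℕ),
          (∀ n ∈ S, N' < (n : ℝ) ∧ (n : ℝ) ≤ 2 * N') → (∀ n : ℕ, ¬ n.Prime → β n = 0) →
          ‖DFI1995.bilinearForm f h (DFI1995.blockAlpha α M) (DFI1995.fiberBeta β S) M N'‖ ≤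
            K₂ * DFI1995.normAlphaRho f (DFI1995.blockAlpha α M) M *
              DFI1995.l2Norm (DFI1995.fiberBeta β S) N' * (M ^ (1 / 2 : ℝ) + N' ^ a * M ^ b)) :
    toth2000_quadraticRoots_primeModuli := by
  refine toth2000_quadraticRoots_primeModuli_of_theorem5 dukeFriedlanderIwaniec1995_theorem5_holds
    (fun f hf hirr hΔ h hh ε hε hε12 => ?_) (fun f hf hirr hΔ h hh ε hε hε12 => ?_)
  · obtain ⟨Cρ, hCρ, hρ⟩ := exists_norm_polyRootWeylSum_le_of_irreducible hf hirr
    obtain ⟨θ, η, K, hθ0, hθ1, hη0, hηε, hK⟩ := HL f hf hirr hΔ h hh ε hε hε12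
    -- make the constant nonnegative
    have hK' : ∀ d : ℕ, 1 ≤ d → ∀ M : ℝ, (d : ℝ) ≤ M →
        ‖DFI1995.linearForm f h d M‖ ≤ max K 0 * (d : ℝ) ^ θ * M ^ (1 - θ + η) := by
      intro d hd M hdM
      have hM0 : 0 ≤ M := le_trans (Nat.cast_nonneg d) hdM
      refine (hK d hd M hdM).trans ?_
      have hnn : 0 ≤ (d : ℝ) ^ θ * M ^ (1 - θ + η) := by positivity
      calc K * (d : ℝ) ^ θ * M ^ (1 - θ + η) = K * ((d : ℝ) ^ θ * M ^ (1 - θ + η)) := by ring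
        _ ≤ max K 0 * ((d : ℝ) ^ θ * M ^ (1 - θ + η)) := mul_le_mul_of_nonneg_right (le_max_left _ _) hnn
        _ = max K 0 * (d : ℝ) ^ θ * M ^ (1 - θ + η) := by ring
    exact DFI1995.hyp34_of_linearFormBound (by linarith) (le_max_right _ _) (hρ h) hθ0 hθ1 hη0 hε
      (by linarith) hηε hK'
  · obtain ⟨Cρ, hCρ, hρ⟩ := exists_norm_polyRootWeylSum_le_of_irreducible hf hirr
    obtain ⟨a, b, K₂, hb0, hab, hκ0, hK₂⟩ := HB f hf hirr hΔ h hh ε hε hε12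
    have hK₂' : ∀ M N' : ℝ, 1 ≤ M → 1 ≤ N' → ∀ (α β : ℕ → ℂ) (S : Finset ℕ),
        (∀ n ∈ S, N' < (n : ℝ) ∧ (n : ℝ) ≤ 2 * N') → (∀ n : ℕ, ¬ n.Prime → β n = 0) →
        ‖DFI1995.bilinearForm f h (DFI1995.blockAlpha α M) (DFI1995.fiberBeta β S) M N'‖ ≤
          max K₂ 0 * DFI1995.normAlphaRho f (DFI1995.blockAlpha α M) M *
            DFI1995.l2Norm (DFI1995.fiberBeta β S) N' * (M ^ (1 / 2 : ℝ) + N' ^ a * M ^ b) := by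
      intro M N' hM hN' α β S hS hβ
      refine (hK₂ M N' hM hN' α β S hS hβ).trans ?_
      have h0 : 0 ≤ DFI1995.normAlphaRho f (DFI1995.blockAlpha α M) M := by
        unfold DFI1995.normAlphaRho; positivity
      have h1 : 0 ≤ DFI1995.l2Norm (DFI1995.fiberBeta β S) N' := by
        unfold DFI1995.l2Norm; positivity
      have hM0 : 0 ≤ M := by linarith
      have hN'0 : 0 ≤ N' := by linarith
      have h3 : 0 ≤ M ^ (1 / 2 : ℝ) + N' ^ a * M ^ b := by positivity
      exact mul_le_mul_of_nonneg_right (mul_le_mul_of_nonneg_right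
        (mul_le_mul_of_nonneg_right (le_max_left _ _) h0) h1) h3
    exact DFI1995.hyp35_of_bilinearFormBound (by linarith) (le_max_right _ _) hρ hε hb0 hab hκ0 hK₂'

/-- **Tóth's theorem from a Tóth-shaped linear-form bound and a bilinear-form bound of shape
`M^{1/2} + N^a M^b` (PROVED reduction)** — the variant of
`toth2000_quadraticRoots_primeModuli_of_linearFormBound_of_bilinearFormBound` with the linear input
in the form printed for Tóth's estimate [cite: Ngo2024, (1.3)]: for all sufficiently large natural
`L`, `|L_d(M)| ≤ K_L (d/M)^{1/(4L)} M^{1+1/L²}` (`1 ≤ d ≤ M`), for every irreducible quadratic of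
positive discriminant and every `h ≥ 1` ((34) then by `DFI1995.hyp34_of_linearFormBound_toth`).
[cite: Toth2000, main theorem]; [cite: DukeFriedlanderIwaniec1995, §7 p. 438] -/
theorem toth2000_quadraticRoots_primeModuli_of_tothLinearFormBound_of_bilinearFormBound
    (HL : ∀ f : ℤ[X], f.natDegree = 2 → Irreducible f →
      0 < discrim (f.coeff 2) (f.coeff 1) (f.coeff 0) → ∀ h : ℕ, 1 ≤ h →
      ∃ L₀ : ℕ, ∀ L : ℕ, L₀ ≤ L → ∃ K : ℝ, ∀ d : ℕ, 1 ≤ d → ∀ M : ℝ, (d : ℝ) ≤ M →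
        ‖DFI1995.linearForm f h d M‖ ≤
          K * ((d : ℝ) / M) ^ (1 / (4 * (L : ℝ))) * M ^ (1 + 1 / (L : ℝ) ^ 2))
    (HB : ∀ f : ℤ[X], f.natDegree = 2 → Irreducible f →
      0 < discrim (f.coeff 2) (f.coeff 1) (f.coeff 0) → ∀ h : ℕ, 1 ≤ h →
      ∀ ε : ℝ, 0 < ε → ε ≤ 1 / 12 →
      ∃ a b K₂ : ℝ, 0 ≤ b ∧ b ≤ a ∧ 0 < 1 / 2 - b - (1 / 3 - ε) * (a - b) ∧
        ∀ M N' : ℝ, 1 ≤ M → 1 ≤ N' → ∀ (α β : ℕ → ℂ) (S : Finset ℕ),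
          (∀ n ∈ S, N' < (n : ℝ) ∧ (n : ℝ) ≤ 2 * N') → (∀ n : ℕ, ¬ n.Prime → β n = 0) →
          ‖DFI1995.bilinearForm f h (DFI1995.blockAlpha α M) (DFI1995.fiberBeta β S) M N'‖ ≤
            K₂ * DFI1995.normAlphaRho f (DFI1995.blockAlpha α M) M *
              DFI1995.l2Norm (DFI1995.fiberBeta β S) N' * (M ^ (1 / 2 : ℝ) + N' ^ a * M ^ b)) :
    toth2000_quadraticRoots_primeModuli := by
  refine toth2000_quadraticRoots_primeModuli_of_tothLinearFormBound_of_hyp35 HL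
    (fun f hf hirr hΔ h hh ε hε hε12 => ?_)
  obtain ⟨Cρ, hCρ, hρ⟩ := exists_norm_polyRootWeylSum_le_of_irreducible hf hirr
  obtain ⟨a, b, K₂, hb0, hab, hκ0, hK₂⟩ := HB f hf hirr hΔ h hh ε hε hε12
  have hK₂' : ∀ M N' : ℝ, 1 ≤ M → 1 ≤ N' → ∀ (α β : ℕ → ℂ) (S : Finset ℕ),
      (∀ n ∈ S, N' < (n : ℝ) ∧ (n : ℝ) ≤ 2 * N') → (∀ n : ℕ, ¬ n.Prime → β n = 0) →
      ‖DFI1995.bilinearForm f h (DFI1995.blockAlpha α M) (DFI1995.fiberBeta β S) M N'‖ ≤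
        max K₂ 0 * DFI1995.normAlphaRho f (DFI1995.blockAlpha α M) M *
          DFI1995.l2Norm (DFI1995.fiberBeta β S) N' * (M ^ (1 / 2 : ℝ) + N' ^ a * M ^ b) := by
    intro M N' hM hN' α β S hS hβ
    refine (hK₂ M N' hM hN' α β S hS hβ).trans ?_
    have h0 : 0 ≤ DFI1995.normAlphaRho f (DFI1995.blockAlpha α M) M := by
      unfold DFI1995.normAlphaRho; positivity
    have h1 : 0 ≤ DFI1995.l2Norm (DFI1995.fiberBeta β S) N' := by
      unfold DFI1995.l2Norm; positivity
    have hM0 : 0 ≤ M := by linarith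
    have hN'0 : 0 ≤ N' := by linarith
    have h3 : 0 ≤ M ^ (1 / 2 : ℝ) + N' ^ a * M ^ b := by positivity
    exact mul_le_mul_of_nonneg_right (mul_le_mul_of_nonneg_right
      (mul_le_mul_of_nonneg_right (le_max_left _ _) h0) h1) h3
  exact DFI1995.hyp35_of_bilinearFormBound (by linarith) (le_max_right _ _) hρ hε hb0 hab hκ0 hK₂'

end Literature.NumberTheory.Sieve
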